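import Summits.BirchSwinnertonDyer.BirchSwinnertonDyer.Theorems.Rank2ObservatoryCubicFieldR1301492
import HarnessLib

/-!
# BirchSwinnertonDyer — rank ≥ 2 observatory: class number one of the cubic field of `-639 + 779 * X - 55 * X ^ 2 + X ^ 3` (`Δ = 1301492`) — certificates at the primes 317

HONEST FRAMING: per-curve certified theorems and census instruments; no claim on BSD in rank ≥ 2.

Companion of the per-FIELD file `Rank2ObservatoryCubicFieldR1301492` of the KERNEL-2DESC instrument (design
`b2b-bsdr2-cert-3/KERNEL-2DESC.md` §9e–§9g): the degree-one prime-element certificates at the primes 317 (part c).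
Split off for file size; generated by the same generator from the same checked data.
Sorry-free; axioms `propext`, `Classical.choice`, `Quot.sound`.
[cite: Marcus2018, Ch. 3 Thm. 27, Ch. 5 Cor. 2 of Thm. 37]
-/

-- single-conjunct summit: `Summit.BirchSwinnertonDyer.BirchSwinnertonDyer.…` repeats the name by design
set_option linter.dupNamespace false

noncomputable section

open scoped Classical NumberField

open Literature.NumberTheory.NumberFields Polynomial Module NumberField

namespace Summit.BirchSwinnertonDyer.BirchSwinnertonDyer.Rank2Observatory.TwoDescCubic

namespace FieldR1301492

/-! ## Class number one -/

/-- Certificate at `317`: every ring map `ψ : 𝓞 K → ℤ/317` kills a prime element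
(`α ↦ 154`: `-3283015 + 3868587 * α - 134461 * α ^ 2` (norm `-317`); `α ↦ 260`: `-538 + 633 * α - 22 * α ^ 2` (norm `-317`); `α ↦ 275`: `-6243998 + 339182 * α - 4135 * α ^ 2` (norm `317`)). [cite: Marcus2018, Ch. 3, Thm. 27] -/
theorem cert317 (ψ : 𝓞 (CubicField (-55) 779 (-639)) →+* ZMod 317) : ∃ e : 𝓞 (CubicField (-55) 779 (-639)), ψ e = 0 ∧ Prime e := by
  refine cert_of_cases aeval_α ψ (fun t ht hF => ?_)
  have hroots : ∀ t : ZMod 317,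
      t ^ 3 + (((-55) : ℤ) : ZMod 317) * t ^ 2 + ((779 : ℤ) : ZMod 317) * t + (((-639) : ℤ) : ZMod 317) = 0 → t = 154 ∨ t = 260 ∨ t = 275 := by
    decide +kernel
  rcases hroots t hF with rfl | rfl | rfl
  · exact ⟨lin aeval_α (-3283015) 3868587 (-134461), by simp only [lin, map_add, map_mul, map_pow, map_intCast, ht]; decide,
      lin_prime_of_prime irreducible aeval_α finrank_eq (-3283015) 3868587 (-134461) (n := (-317))
        (by norm_num [MonicCubic.normForm]) (by norm_num)⟩
  · exact ⟨lin aeval_α (-538) 633 (-22), by simp only [lin, map_add, map_mul, map_pow, map_intCast, ht]; decide,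
      lin_prime_of_prime irreducible aeval_α finrank_eq (-538) 633 (-22) (n := (-317))
        (by norm_num [MonicCubic.normForm]) (by norm_num)⟩
  · exact ⟨lin aeval_α (-6243998) 339182 (-4135), by simp only [lin, map_add, map_mul, map_pow, map_intCast, ht]; decide,
      lin_prime_of_prime irreducible aeval_α finrank_eq (-6243998) 339182 (-4135) (n := 317)
        (by norm_num [MonicCubic.normForm]) (by norm_num)⟩

end FieldR1301492

end Summit.BirchSwinnertonDyer.BirchSwinnertonDyer.Rank2Observatory.TwoDescCubic

end
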